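import Summits.CriticalPhenomena.PercolationContinuityZ3.Theorems.PercNearOneGluingNoHeavyLowerTailKnQuestion8AntitheticApex
import HarnessLib

/-!
# `NoHeavyLowerTail` (crux stmt-CriticalPhenomena-4575), antithetic vdBHK programme: tools for the GENERALIZED APEX LEMMA (tool T20): counting lemmas and the
# up-set property of the surgery sets

Support file (seat `prim-ineq-gen-7` gen 45; `--supports stmt-CriticalPhenomena-4575`).  No `sorry`, no definitions.
Memo: run/shared/lean/prim/prim-ineq-gen-7/FINDING-AK-g45.md §3.

SETTING (as in `AntitheticApex`).  `Y` a finite partial order with an involution `ι`, antipodal Kleitman (AK) in up-set form.  Let `F ⊆ Y` be a set of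
points with `F × ιF ⊆ (≤)` (`f ≤ ι g` for all `f, g ∈ F`) and `F ∩ ιF = ∅`.  The extension `A(Y;F)` is `Y × {0,1}` with `(y,i) ≤ (y',j) ⟺ y ≤ y'` and:
`i = j` if `y = y' ∈ F ∪ ιF` (no rungs over `F`, `ιF`), anything if `y ∈ F, y' ∈ ιF`, and `i ≤ j` otherwise; involution `(y,i) ↦ (ι y, 1-i)`.  (For `F`
minimal and `ιF` maximal this is a poset; extremality is not used by the inequality.)  `F = {r}` is the apex lemma T18.  ITERATION: for an AK `X` with
`r ≤ ι r` the poset `A_q(X) := X × 2^q` with the two fibres over `r`, `ι r` made antichains and `{r} × 2^q < {ι r} × 2^q` satisfies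
`A_q(X) = A(A_{q-1}(X); {r} × 2^{q-1})`, so it is AK for every `q` (MULTI-APEX).  Antimatroid meaning: `A_q(Ω_P) = Ω_{P ⊕ A_q}` — adding `q` pairwise
incomparable TOP elements above everything preserves AK of the poset antimatroid (`q = 1`: apex); e.g. all complete bipartite posets `K_{p,q}`.
Up-sets of `A(Y;F)` are the pairs `(U₀,U₁)` of up-sets of `Y` with (α) `U₀ ∖ (F ∪ ιF) ⊆ U₁`, (β) `f ∈ U₀ ∩ F, f ≤ y, y ∉ F ∪ ιF ⟹ y ∈ U₁`,
(γ) `(U₀ ∪ U₁) ∩ F ≠ ∅ ⟹ ιF ⊆ U₀ ∩ U₁`.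
This file: `card_split3`, `card_filter_invol_le/eq`, `mem_surgery`, `card_nested_ineq`, `up_surgery0/1`, `surgery_nested` (tools).
The theorem itself is in `…KnQuestion8AntitheticMultiApex.lean`:
* `AntitheticMultiApex.generalized_apex_ak` — **T20**: `#(U₀ ∩ ιW₁) + #(U₁ ∩ ιW₀) ≤ #(U₀ ∩ W₀) + #(U₁ ∩ W₁)` for all such pairs.  PROOF (surgery to the
  product `Y × {0<1}`): `Ũ₁ := U₁ ∪ (U₀ ∩ F)`, and over `ιF` keep only the FORCED points (all of `ιF` if `(U₀∪U₁) ∩ F ≠ ∅`, else `ιF ∩ ↑(U_i ∖ (F∪ιF))`);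
  then `(Ũ₀ ⊆ Ũ₁)` is a product pair, `AntitheticApex.chain_product_ak` applies, and a four-case count shows the product deficit dominates.
-/

namespace Summit.CriticalPhenomena.PercolationContinuityZ3.Theorems

open Finset

namespace AntitheticMultiApex

variable {Y : Type*} [DecidableEq Y] [PartialOrder Y]

omit [PartialOrder Y] in
/-- Three-way split of a cardinality along `F`, `ιF` and the rest. [this work] -/
theorem card_split3 (ι : Y → Y) (F : Finset Y) (hFι : ∀ f ∈ F, ι f ∉ F) (A : Finset Y) :
    A.card = (A.filter (fun y => y ∈ F)).card + (A.filter (fun y => ι y ∈ F)).card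
      + (A.filter (fun y => y ∉ F ∧ ι y ∉ F)).card := by
  have h1 : (A.filter (fun y => y ∈ F)).card + (A.filter (fun y => ¬ (y ∈ F))).card = A.card :=
    Finset.card_filter_add_card_filter_not _
  have h2 : ((A.filter (fun y => ¬ (y ∈ F))).filter (fun y => ι y ∈ F)).card
      + ((A.filter (fun y => ¬ (y ∈ F))).filter (fun y => ¬ (ι y ∈ F))).card = (A.filter (fun y => ¬ (y ∈ F))).card :=
    Finset.card_filter_add_card_filter_not _
  have e1 : (A.filter (fun y => ¬ (y ∈ F))).filter (fun y => ι y ∈ F) = A.filter (fun y => ι y ∈ F) := by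
    ext y
    simp only [Finset.mem_filter]
    constructor
    · rintro ⟨⟨hA, _⟩, h⟩; exact ⟨hA, h⟩
    · rintro ⟨hA, h⟩
      refine ⟨⟨hA, fun hy => ?_⟩, h⟩
      exact hFι y hy (by
        -- y ∈ F and ι y ∈ F: then ι (ι y)... use hFι on ι y? we need ι y ∉ F from y ∈ F
        exact h)
  have e2 : (A.filter (fun y => ¬ (y ∈ F))).filter (fun y => ¬ (ι y ∈ F)) = A.filter (fun y => y ∉ F ∧ ι y ∉ F) := by
    ext y
    simp only [Finset.mem_filter]
    tauto
  rw [e1, e2] at h2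
  omega

omit [PartialOrder Y] in
/-- Transport of a count through the involution with a defect set: `#{y ∈ A : ι y ∈ P} ≤ #{y ∈ A : ι y ∈ Q} + #(P ∖ Q)`. [this work] -/
theorem card_filter_invol_le (ι : Y → Y) (hιι : Function.Involutive ι) (A P Q : Finset Y) :
    (A.filter (fun y => ι y ∈ P)).card ≤ (A.filter (fun y => ι y ∈ Q)).card + (P \ Q).card := by
  have hsub : A.filter (fun y => ι y ∈ P) ⊆ A.filter (fun y => ι y ∈ Q) ∪ (P \ Q).image ι := by
    intro y hy
    rw [Finset.mem_filter] at hy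
    rw [Finset.mem_union, Finset.mem_filter, AntitheticApex.mem_image_invol ι hιι]
    by_cases hq : ι y ∈ Q
    · exact Or.inl ⟨hy.1, hq⟩
    · exact Or.inr (Finset.mem_sdiff.2 ⟨hy.2, hq⟩)
  calc (A.filter (fun y => ι y ∈ P)).card ≤ (A.filter (fun y => ι y ∈ Q) ∪ (P \ Q).image ι).card := Finset.card_le_card hsub
    _ ≤ (A.filter (fun y => ι y ∈ Q)).card + ((P \ Q).image ι).card := Finset.card_union_le _ _
    _ ≤ (A.filter (fun y => ι y ∈ Q)).card + (P \ Q).card := by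
        have := Finset.card_image_le (s := P \ Q) (f := ι); omega

omit [PartialOrder Y] in
/-- Counting through the involution exactly: `#{y ∈ ιB : ι y ∈ P} = #(B ∩ P)` when... general form `#(A.filter (ι · ∈ P)) = #((A.image ι) ∩ P)`. [this work] -/
theorem card_filter_invol_eq (ι : Y → Y) (hιι : Function.Involutive ι) (A P : Finset Y) :
    (A.filter (fun y => ι y ∈ P)).card = (A.image ι ∩ P).card := by
  have : (A.filter (fun y => ι y ∈ P)).image ι = A.image ι ∩ P := by
    ext z
    simp only [Finset.mem_image, Finset.mem_filter, Finset.mem_inter]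
    constructor
    · rintro ⟨y, ⟨hyA, hyP⟩, rfl⟩; exact ⟨⟨y, hyA, rfl⟩, hyP⟩
    · rintro ⟨⟨y, hyA, rfl⟩, hzP⟩; exact ⟨y, ⟨hyA, hzP⟩, rfl⟩
  rw [← this, Finset.card_image_of_injective _ hιι.injective]

omit [PartialOrder Y] in
/-- Membership in a surgery set `A.filter (· ∈ F) ∪ N ∪ T` by region (`N` inside the middle, `T` inside `ιF`). [this work] -/
theorem mem_surgery (ι : Y → Y) (F : Finset Y) (hFι : ∀ f ∈ F, ι f ∉ F) (A N T : Finset Y)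
    (hN : ∀ y, y ∈ N → y ∉ F ∧ ι y ∉ F) (hT : ∀ y, y ∈ T → ι y ∈ F) (y : Y) :
    (y ∈ F → (y ∈ A.filter (fun y => y ∈ F) ∪ N ∪ T ↔ y ∈ A)) ∧
    (ι y ∈ F → (y ∈ A.filter (fun y => y ∈ F) ∪ N ∪ T ↔ y ∈ T)) ∧
    (y ∉ F → ι y ∉ F → (y ∈ A.filter (fun y => y ∈ F) ∪ N ∪ T ↔ y ∈ N)) := by
  simp only [Finset.mem_union, Finset.mem_filter]
  refine ⟨fun hyF => ?_, fun hyG => ?_, fun hyF hyG => ?_⟩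
  · constructor
    · rintro ((⟨hA, _⟩ | hNy) | hTy)
      · exact hA
      · exact absurd hyF (hN y hNy).1
      · exact absurd (hT y hTy) (hFι y hyF)
    · intro hA; exact Or.inl (Or.inl ⟨hA, hyF⟩)
  · have hyF : y ∉ F := fun h => hFι y h hyG
    constructor
    · rintro ((⟨_, h⟩ | hNy) | hTy)
      · exact absurd h hyF
      · exact absurd hyG (hN y hNy).2
      · exact hTy
    · intro hTy; exact Or.inr hTy
  · constructor
    · rintro ((⟨_, h⟩ | hNy) | hTy)
      · exact absurd h hyF
      · exact hNy
      · exact absurd (hT y hTy) hyG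
    · intro hNy; exact Or.inl (Or.inr hNy)

omit [PartialOrder Y] in
/-- For nested finite sets `A ⊆ A'`, `B ⊆ B'`: `#(A' ∩ B') + #A + #B ≤ #(A ∩ B) + #A' + #B'`. [this work] -/
theorem card_nested_ineq (A A' B B' : Finset Y) (hA : A ⊆ A') (hB : B ⊆ B') :
    (A' ∩ B').card + A.card + B.card ≤ (A ∩ B).card + A'.card + B'.card := by
  have h1 : A' ∩ B' ⊆ (A ∩ B) ∪ ((A' \ A) ∪ (B' \ B)) := by
    intro y hy
    obtain ⟨hyA', hyB'⟩ := Finset.mem_inter.1 hy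
    rw [Finset.mem_union, Finset.mem_union, Finset.mem_inter, Finset.mem_sdiff, Finset.mem_sdiff]
    by_cases hyA : y ∈ A
    · by_cases hyB : y ∈ B
      · exact Or.inl ⟨hyA, hyB⟩
      · exact Or.inr (Or.inr ⟨hyB', hyB⟩)
    · exact Or.inr (Or.inl ⟨hyA', hyA⟩)
  have h2 := Finset.card_le_card h1
  have h3 := Finset.card_union_le (A ∩ B) ((A' \ A) ∪ (B' \ B))
  have h4 := Finset.card_union_le (A' \ A) (B' \ B)
  have h5 := Finset.card_sdiff_add_card_eq_card hA
  have h6 := Finset.card_sdiff_add_card_eq_card hB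
  omega

section Surgery
open Classical

/-- The layer-0 surgery set is an up-set. [this work] -/
theorem up_surgery0 (ι : Y → Y) (hιι : Function.Involutive ι) (F : Finset Y) (hFι : ∀ f ∈ F, ι f ∉ F)
    (U₀ U₁ : Finset Y) (hU₀ : ∀ x y, x ≤ y → x ∈ U₀ → y ∈ U₀)
    (hUc : ∀ f g, f ∈ F → g ∈ F → (f ∈ U₀ ∨ f ∈ U₁) → (ι g ∈ U₀ ∧ ι g ∈ U₁))
    (N0 T0 V0 : Finset Y) (hN0 : N0 = U₀.filter (fun y => y ∉ F ∧ ι y ∉ F))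
    (hT0 : T0 = (F.image ι).filter (fun g => (∃ f ∈ F, f ∈ U₀ ∨ f ∈ U₁) ∨ ∃ w ∈ N0, w ≤ g))
    (hV0 : V0 = U₀.filter (fun y => y ∈ F) ∪ N0 ∪ T0) :
    ∀ x y, x ≤ y → x ∈ V0 → y ∈ V0 := by
  classical
  have memG : ∀ y : Y, y ∈ F.image ι ↔ ι y ∈ F := fun y => AntitheticApex.mem_image_invol ι hιι F y
  have hN : ∀ y, y ∈ N0 → y ∉ F ∧ ι y ∉ F := by intro y hy; rw [hN0] at hy; exact (Finset.mem_filter.1 hy).2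
  have hT : ∀ y, y ∈ T0 → ι y ∈ F := by intro y hy; rw [hT0] at hy; exact (memG y).1 (Finset.mem_filter.1 hy).1
  have hTU : ∀ y, y ∈ T0 → y ∈ U₀ := by
    intro y hy
    rw [hT0] at hy
    obtain ⟨hyG, hc⟩ := Finset.mem_filter.1 hy
    rcases hc with ⟨f, hfF, hf⟩ | ⟨w, hw, hwy⟩
    · have := (hUc f (ι y) hfF ((memG y).1 hyG) hf).1; rwa [hιι y] at this
    · rw [hN0] at hw; exact hU₀ w y hwy (Finset.mem_filter.1 hw).1
  intro x y hxy hx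
  rw [hV0] at hx ⊢
  have mx := mem_surgery ι F hFι U₀ N0 T0 hN hT x
  have my := mem_surgery ι F hFι U₀ N0 T0 hN hT y
  -- x ∈ U₀ and the forcing condition for y
  have key : x ∈ U₀ ∧ ((∃ f ∈ F, f ∈ U₀ ∨ f ∈ U₁) ∨ ∃ w ∈ N0, w ≤ y) := by
    by_cases hxF : x ∈ F
    · have hxU : x ∈ U₀ := (mx.1 hxF).1 hx
      exact ⟨hxU, Or.inl ⟨x, hxF, Or.inl hxU⟩⟩
    · by_cases hxG : ι x ∈ F
      · have hxT : x ∈ T0 := (mx.2.1 hxG).1 hx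
        refine ⟨hTU x hxT, ?_⟩
        rw [hT0] at hxT
        rcases (Finset.mem_filter.1 hxT).2 with h | ⟨w, hw, hwx⟩
        · exact Or.inl h
        · exact Or.inr ⟨w, hw, le_trans hwx hxy⟩
      · have hxN : x ∈ N0 := (mx.2.2 hxF hxG).1 hx
        have hxU : x ∈ U₀ := by rw [hN0] at hxN; exact (Finset.mem_filter.1 hxN).1
        exact ⟨hxU, Or.inr ⟨x, hxN, hxy⟩⟩
  have hyU : y ∈ U₀ := hU₀ x y hxy key.1
  by_cases hyF : y ∈ F
  · exact (my.1 hyF).2 hyU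
  · by_cases hyG : ι y ∈ F
    · refine (my.2.1 hyG).2 ?_
      rw [hT0]; exact Finset.mem_filter.2 ⟨(memG y).2 hyG, key.2⟩
    · refine (my.2.2 hyF hyG).2 ?_
      rw [hN0]; exact Finset.mem_filter.2 ⟨hyU, hyF, hyG⟩

/-- The layer-1 surgery set is an up-set. [this work] -/
theorem up_surgery1 (ι : Y → Y) (hιι : Function.Involutive ι) (F : Finset Y) (hFι : ∀ f ∈ F, ι f ∉ F)
    (U₀ U₁ : Finset Y) (hU₀ : ∀ x y, x ≤ y → x ∈ U₀ → y ∈ U₀) (hU₁ : ∀ x y, x ≤ y → x ∈ U₁ → y ∈ U₁)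
    (hUb : ∀ f y, f ∈ F → f ∈ U₀ → f ≤ y → y ∉ F → ι y ∉ F → y ∈ U₁)
    (hUc : ∀ f g, f ∈ F → g ∈ F → (f ∈ U₀ ∨ f ∈ U₁) → (ι g ∈ U₀ ∧ ι g ∈ U₁))
    (N1 T1 V1 : Finset Y) (hN1 : N1 = U₁.filter (fun y => y ∉ F ∧ ι y ∉ F))
    (hT1 : T1 = (F.image ι).filter (fun g => (∃ f ∈ F, f ∈ U₀ ∨ f ∈ U₁) ∨ ∃ w ∈ N1, w ≤ g))
    (hV1 : V1 = (U₀ ∪ U₁).filter (fun y => y ∈ F) ∪ N1 ∪ T1) :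
    ∀ x y, x ≤ y → x ∈ V1 → y ∈ V1 := by
  classical
  have memG : ∀ y : Y, y ∈ F.image ι ↔ ι y ∈ F := fun y => AntitheticApex.mem_image_invol ι hιι F y
  have hN : ∀ y, y ∈ N1 → y ∉ F ∧ ι y ∉ F := by intro y hy; rw [hN1] at hy; exact (Finset.mem_filter.1 hy).2
  have hT : ∀ y, y ∈ T1 → ι y ∈ F := by intro y hy; rw [hT1] at hy; exact (memG y).1 (Finset.mem_filter.1 hy).1
  have hTU : ∀ y, y ∈ T1 → y ∈ U₁ := by
    intro y hy
    rw [hT1] at hy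
    obtain ⟨hyG, hc⟩ := Finset.mem_filter.1 hy
    rcases hc with ⟨f, hfF, hf⟩ | ⟨w, hw, hwy⟩
    · have := (hUc f (ι y) hfF ((memG y).1 hyG) hf).2; rwa [hιι y] at this
    · rw [hN1] at hw; exact hU₁ w y hwy (Finset.mem_filter.1 hw).1
  intro x y hxy hx
  rw [hV1] at hx ⊢
  have mx := mem_surgery ι F hFι (U₀ ∪ U₁) N1 T1 hN hT x
  have my := mem_surgery ι F hFι (U₀ ∪ U₁) N1 T1 hN hT y
  -- y ∈ U₀ ∪ U₁; y ∈ U₁ unless (x,y both in F-source...) ; and forcing condition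
  have key : (y ∈ U₀ ∪ U₁) ∧ (y ∉ F → y ∈ U₁) ∧ ((∃ f ∈ F, f ∈ U₀ ∨ f ∈ U₁) ∨ ∃ w ∈ N1, w ≤ y) := by
    by_cases hxF : x ∈ F
    · have hxU : x ∈ U₀ ∪ U₁ := (mx.1 hxF).1 hx
      rcases Finset.mem_union.1 hxU with h0 | h1
      · refine ⟨Finset.mem_union.2 (Or.inl (hU₀ x y hxy h0)), fun hyF => ?_, Or.inl ⟨x, hxF, Or.inl h0⟩⟩
        by_cases hyG : ι y ∈ F
        · have := (hUc x (ι y) hxF hyG (Or.inl h0)).2; rwa [hιι y] at this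
        · exact hUb x y hxF h0 hxy hyF hyG
      · exact ⟨Finset.mem_union.2 (Or.inr (hU₁ x y hxy h1)), fun _ => hU₁ x y hxy h1, Or.inl ⟨x, hxF, Or.inr h1⟩⟩
    · by_cases hxG : ι x ∈ F
      · have hxT : x ∈ T1 := (mx.2.1 hxG).1 hx
        have hxU : x ∈ U₁ := hTU x hxT
        refine ⟨Finset.mem_union.2 (Or.inr (hU₁ x y hxy hxU)), fun _ => hU₁ x y hxy hxU, ?_⟩
        rw [hT1] at hxT
        rcases (Finset.mem_filter.1 hxT).2 with h | ⟨w, hw, hwx⟩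
        · exact Or.inl h
        · exact Or.inr ⟨w, hw, le_trans hwx hxy⟩
      · have hxN : x ∈ N1 := (mx.2.2 hxF hxG).1 hx
        have hxU : x ∈ U₁ := by rw [hN1] at hxN; exact (Finset.mem_filter.1 hxN).1
        exact ⟨Finset.mem_union.2 (Or.inr (hU₁ x y hxy hxU)), fun _ => hU₁ x y hxy hxU, Or.inr ⟨x, hxN, hxy⟩⟩
  by_cases hyF : y ∈ F
  · exact (my.1 hyF).2 key.1
  · by_cases hyG : ι y ∈ F
    · refine (my.2.1 hyG).2 ?_
      rw [hT1]; exact Finset.mem_filter.2 ⟨(memG y).2 hyG, key.2.2⟩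
    · refine (my.2.2 hyF hyG).2 ?_
      rw [hN1]; exact Finset.mem_filter.2 ⟨key.2.1 hyF, hyF, hyG⟩

/-- Nesting of the surgery layers: `V0 ⊆ V1`. [this work] -/
theorem surgery_nested (ι : Y → Y) (F : Finset Y)
    (U₀ U₁ : Finset Y) (hUa : ∀ y, y ∉ F → ι y ∉ F → y ∈ U₀ → y ∈ U₁)
    (N0 N1 T0 T1 V0 V1 : Finset Y) (hN0 : N0 = U₀.filter (fun y => y ∉ F ∧ ι y ∉ F)) (hN1 : N1 = U₁.filter (fun y => y ∉ F ∧ ι y ∉ F))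
    (hT0 : T0 = (F.image ι).filter (fun g => (∃ f ∈ F, f ∈ U₀ ∨ f ∈ U₁) ∨ ∃ w ∈ N0, w ≤ g))
    (hT1 : T1 = (F.image ι).filter (fun g => (∃ f ∈ F, f ∈ U₀ ∨ f ∈ U₁) ∨ ∃ w ∈ N1, w ≤ g))
    (hV0 : V0 = U₀.filter (fun y => y ∈ F) ∪ N0 ∪ T0) (hV1 : V1 = (U₀ ∪ U₁).filter (fun y => y ∈ F) ∪ N1 ∪ T1) :
    V0 ⊆ V1 := by
  classical
  have hN01 : N0 ⊆ N1 := by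
    intro y hy; rw [hN0] at hy; rw [hN1]
    obtain ⟨hyU, hyF, hyG⟩ := Finset.mem_filter.1 hy
    exact Finset.mem_filter.2 ⟨hUa y hyF hyG hyU, hyF, hyG⟩
  have hT01 : T0 ⊆ T1 := by
    intro y hy; rw [hT0] at hy; rw [hT1]
    obtain ⟨hyG, hc⟩ := Finset.mem_filter.1 hy
    refine Finset.mem_filter.2 ⟨hyG, ?_⟩
    rcases hc with h | ⟨w, hw, hwy⟩
    · exact Or.inl h
    · exact Or.inr ⟨w, hN01 hw, hwy⟩
  intro y hy
  rw [hV0] at hy; rw [hV1]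
  simp only [Finset.mem_union, Finset.mem_filter] at hy ⊢
  rcases hy with (⟨hyU, hyF⟩ | hyN) | hyT
  · exact Or.inl (Or.inl ⟨Or.inl hyU, hyF⟩)
  · exact Or.inl (Or.inr (hN01 hyN))
  · exact Or.inr (hT01 hyT)


end Surgery

end AntitheticMultiApex

end Summit.CriticalPhenomena.PercolationContinuityZ3.Theorems
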